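import Mathlib
import Summits.FinalStateConjecture.FinalStateConjecture.Theses.ZeroEnergyKerrOrBomb
import Literature.Geometry.Lorentzian.KillingModeStability
import Literature.Geometry.Lorentzian.StationaryFinalStateDecomposition

/-!
# Sketch — crux `ZeroEnergyKerrOrBomb.StationaryLimitReduction` (stmt-FinalStateConjecture-10021),
crux-ideate round 1, ideator 3

First lemmas of the two idea cards filed by this seat:

* card `test-waves-certify-the-limit`: `modeRoughness` (abstract, rate-free heart),
  `chargeWindow` (the `κ = 0` / Aretakis-charge endpoint of the same window argument),
  the typed interface `InTelescope`, `kerrOrBomb_iff_telescope`, `ForwardTestBounded`,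
  `LimitHolesAreModeStable`, `LimitHolesAreKerr`;
* card `escape-along-the-explosion`: `topModeDominance` (abstract heart of the strong-unstable
  shadowing step).

Nothing here is an item; every declaration is proved (no `sorry`).
-/

noncomputable section

open Filter Topology Set
open scoped Manifold ENNReal

namespace Summit.FinalStateConjecture.FinalStateConjecture.Cruxes.StationaryLimitReduction.Ideator3

/-! ## Card `test-waves-certify-the-limit` — abstract hearts -/

section ModeRoughness

variable {𝕜 E : Type*} [NontriviallyNormedField 𝕜] [NormedAddCommGroup E] [NormedSpace 𝕜 E]

/-- Non-autonomous discrete propagator: start at absolute step `s` and apply the one-step maps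
`Q s, Q (s + 1), …, Q (s + n - 1)` in turn. -/
def orbit (Q : ℕ → E → E) (s : ℕ) : ℕ → E → E
  | 0 => id
  | n + 1 => Q (s + n) ∘ orbit Q s n

@[simp] theorem orbit_zero (Q : ℕ → E → E) (s : ℕ) (x : E) : orbit Q s 0 x = x := rfl

@[simp] theorem orbit_succ (Q : ℕ → E → E) (s n : ℕ) (x : E) :
    orbit Q s (n + 1) x = Q (s + n) (orbit Q s n x) := rfl

theorem orbit_succ_left (Q : ℕ → E → E) (s n : ℕ) (x : E) :
    orbit Q s (n + 1) x = orbit Q (s + 1) n (Q s x) := by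
  induction n with
  | zero => simp
  | succ n ih =>
    rw [orbit_succ, ih, orbit_succ]
    have h : s + (n + 1) = s + 1 + n := by omega
    rw [h]

theorem orbit_map_sub (Q : ℕ → E →ₗ[𝕜] E) (s n : ℕ) (x y : E) :
    orbit (fun k ↦ ⇑(Q k)) s n (x - y) =
      orbit (fun k ↦ ⇑(Q k)) s n x - orbit (fun k ↦ ⇑(Q k)) s n y := by
  induction n with
  | zero => simp
  | succ n ih => simp [orbit_succ, ih, map_sub]

theorem orbit_map_smul (Q : ℕ → E →ₗ[𝕜] E) (s n : ℕ) (c : 𝕜) (x : E) :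
    orbit (fun k ↦ ⇑(Q k)) s n (c • x) = c • orbit (fun k ↦ ⇑(Q k)) s n x := by
  induction n with
  | zero => simp
  | succ n ih => simp [orbit_succ, ih, map_smul]

/-- **MODE ROUGHNESS (rate-free).** If the one-step maps `Q n` converge to `T` ON A SINGLE
VECTOR `v` which is an eigenvector of `T` with `‖μ‖ > 1`, then the non-autonomous propagators
`orbit Q s n` admit NO bound `‖orbit Q s n x‖ ≤ M ‖x‖` uniform in the start time `s`, the length
`n` and the datum `x`. (Duhamel: `orbit Q s n v - μ^n v = ∑_{j<n} orbit Q (s+j+1) (n-1-j)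
(μ^j • (Q (s+j) v - T v))`, each term `≤ M ‖μ‖^j δ_{s+j}`; for `s` late the sum is
`≤ ‖μ‖^n ‖v‖ / 4`, so `‖orbit Q s n v‖ ≥ (3/4) ‖μ‖^n ‖v‖ → ∞`, contradicting `≤ M ‖v‖` at
`n ≈ log M / log ‖μ‖`.) In the line: `E` = test-wave data near hole `i` read in the adapted chart,
`T` = time-one map of `□` on the limit hole `𝓑ᵢ`, `v` = data of a growing Killing mode
(`IsKillingModePair … ν ω ψ χ`, `ν > 0`, `μ = e^{ν + iω}`), `Q n` = the development's one-step
maps at late chart times, `δ → 0` = `C²` slab convergence of `d.toOver` (no rate needed),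
`M` = the constant of `ForwardTestBounded`. -/
theorem modeRoughness (T : E →ₗ[𝕜] E) (Q : ℕ → E →ₗ[𝕜] E) (v : E) (μ : 𝕜)
    (hv : v ≠ 0) (hTv : T v = μ • v) (hμ : 1 < ‖μ‖)
    (hQ : Tendsto (fun n ↦ ‖Q n v - T v‖) atTop (𝓝 0)) :
    ¬ ∃ M : ℝ, ∀ (s n : ℕ) (x : E), ‖orbit (fun n ↦ ⇑(Q n)) s n x‖ ≤ M * ‖x‖ := by
  rintro ⟨M, hM⟩
  set Q' : ℕ → E → E := fun n ↦ ⇑(Q n) with hQ'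
  have hvpos : 0 < ‖v‖ := norm_pos_iff.mpr hv
  -- M ≥ 1 > 0 (take n = 0)
  have hM1 : 1 ≤ M := by
    have h := hM 0 0 v
    simp only [orbit_zero] at h
    nlinarith
  have hMpos : 0 < M := by linarith
  have hμ1 : 0 < ‖μ‖ - 1 := by linarith
  -- late start: the one-step defect on `v` is below `η`
  set η : ℝ := (‖μ‖ - 1) * ‖v‖ / (2 * M) with hη
  have hηpos : 0 < η := by positivity
  obtain ⟨S₀, hS₀⟩ : ∃ S₀, ∀ k ≥ S₀, ‖Q k v - T v‖ ≤ η := by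
    have h1 : ∀ᶠ k in atTop, ‖Q k v - T v‖ < η := hQ.eventually (gt_mem_nhds hηpos)
    obtain ⟨S₀, hS₀⟩ := eventually_atTop.mp h1
    exact ⟨S₀, fun k hk ↦ (hS₀ k hk).le⟩
  set C : ℝ := M * η / (‖μ‖ - 1) with hC
  have hCv : C = ‖v‖ / 2 := by
    rw [hC, hη]
    field_simp
  -- Duhamel bound, by induction on `n`, uniformly in the start `s ≥ S₀`
  have key : ∀ n : ℕ, ∀ s : ℕ, S₀ ≤ s →
      ‖orbit Q' s n v - μ ^ n • v‖ ≤ C * (‖μ‖ ^ n - 1) := by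
    intro n
    induction n with
    | zero => intro s _; simp
    | succ n ih =>
      intro s hs
      have hcoc : orbit Q' s (n + 1) v = orbit Q' (s + 1) n (Q s v) := orbit_succ_left Q' s n v
      have hsplit : orbit Q' (s + 1) n (Q s v) =
          orbit Q' (s + 1) n (Q s v - T v) + μ • orbit Q' (s + 1) n v := by
        have h1 : orbit Q' (s + 1) n (Q s v - T v) =
            orbit Q' (s + 1) n (Q s v) - orbit Q' (s + 1) n (T v) := orbit_map_sub Q (s + 1) n _ _
        have h2 : orbit Q' (s + 1) n (T v) = μ • orbit Q' (s + 1) n v := by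
          rw [hTv]; exact orbit_map_smul Q (s + 1) n μ v
        rw [h1, h2]; abel
      have hdef : ‖orbit Q' (s + 1) n (Q s v - T v)‖ ≤ M * η :=
        (hM (s + 1) n _).trans (mul_le_mul_of_nonneg_left (hS₀ s hs) hMpos.le)
      have ih' := ih (s + 1) (Nat.le_succ_of_le hs)
      have hrew : orbit Q' s (n + 1) v - μ ^ (n + 1) • v =
          orbit Q' (s + 1) n (Q s v - T v) + μ • (orbit Q' (s + 1) n v - μ ^ n • v) := by
        rw [hcoc, hsplit, smul_sub, smul_smul, ← pow_succ']; abel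
      calc ‖orbit Q' s (n + 1) v - μ ^ (n + 1) • v‖
          = ‖orbit Q' (s + 1) n (Q s v - T v) + μ • (orbit Q' (s + 1) n v - μ ^ n • v)‖ := by
            rw [hrew]
        _ ≤ ‖orbit Q' (s + 1) n (Q s v - T v)‖ + ‖μ • (orbit Q' (s + 1) n v - μ ^ n • v)‖ :=
            norm_add_le _ _
        _ ≤ M * η + ‖μ‖ * (C * (‖μ‖ ^ n - 1)) := by
            rw [norm_smul]
            exact add_le_add hdef (mul_le_mul_of_nonneg_left ih' (norm_nonneg _))
        _ = C * (‖μ‖ ^ (n + 1) - 1) := by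
            rw [hC, pow_succ]; field_simp; ring
  -- hence growth along the mode, against the uniform bound
  have hgrow : ∀ n : ℕ, ‖μ‖ ^ n * (‖v‖ / 2) ≤ M * ‖v‖ := by
    intro n
    have h1 := key n S₀ le_rfl
    have h2 : ‖μ ^ n • v‖ = ‖μ‖ ^ n * ‖v‖ := by rw [norm_smul, norm_pow]
    have h3 : ‖μ ^ n • v‖ - ‖orbit Q' S₀ n v - μ ^ n • v‖ ≤ ‖orbit Q' S₀ n v‖ := by
      have := norm_sub_norm_le (μ ^ n • v) (μ ^ n • v - orbit Q' S₀ n v)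
      rw [sub_sub_cancel, norm_sub_rev] at this
      linarith
    have h4 := hM S₀ n v
    have h5 : 0 ≤ C := by rw [hCv]; positivity
    nlinarith [h1, h2, h3, h4, h5, pow_nonneg (norm_nonneg μ) n]
  have hbdd : ∀ n : ℕ, ‖μ‖ ^ n ≤ 2 * M := by
    intro n
    have := hgrow n
    nlinarith
  have hunb := tendsto_pow_atTop_atTop_of_one_lt hμ
  obtain ⟨n, hn⟩ := (hunb.eventually (eventually_gt_atTop (2 * M))).exists
  exact absurd (hbdd n) (not_le.mpr hn)

end ModeRoughness

/-- **CHARGE WINDOW** (the `κ = 0` endpoint of the same argument, abstract form). A quantity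
`a s n` (the Aretakis-type horizon charge of the test wave started at late time `s`, read `n`
steps later, normalised to `a s 0 = 1`) that is conserved up to `M · δ (s + n)` per step with
`δ → 0` cannot obey a start-time-uniform decay profile `|a s n| ≤ ρ n`, `ρ → 0`. -/
theorem chargeWindow (a : ℕ → ℕ → ℝ) (δ ρ : ℕ → ℝ) (M : ℝ)
    (h0 : ∀ s, a s 0 = 1)
    (hcons : ∀ s n, |a s (n + 1) - a s n| ≤ M * δ (s + n))
    (hδ : Tendsto δ atTop (𝓝 0))
    (hdecay : ∀ s n, |a s n| ≤ ρ n)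
    (hρ : Tendsto ρ atTop (𝓝 0)) : False := by
  obtain ⟨n₀, hn₀⟩ : ∃ n₀, ρ n₀ < 1 / 2 :=
    (hρ.eventually (gt_mem_nhds (by norm_num : (0 : ℝ) < 1 / 2))).exists
  set K : ℝ := |M| + 1 with hK
  have hKpos : 0 < K := by positivity
  set ε : ℝ := 1 / (4 * K * (n₀ + 1)) with hε
  have hεpos : 0 < ε := by positivity
  obtain ⟨S, hS⟩ : ∃ S, ∀ k ≥ S, |δ k| < ε := by
    have h1 : Tendsto (fun k ↦ |δ k|) atTop (𝓝 0) := by simpa using hδ.abs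
    exact eventually_atTop.mp (h1.eventually (gt_mem_nhds hεpos))
  have key : ∀ n, n ≤ n₀ → |a S n - 1| ≤ n * K * ε := by
    intro n
    induction n with
    | zero => intro _; simp [h0]
    | succ n ih =>
      intro hn
      have ih' := ih (Nat.le_of_succ_le hn)
      have h1 : |a S (n + 1) - a S n| ≤ M * δ (S + n) := hcons S n
      have hd : |δ (S + n)| < ε := hS (S + n) (Nat.le_add_right S n)
      have h2 : M * δ (S + n) ≤ K * ε := by
        calc M * δ (S + n) ≤ |M * δ (S + n)| := le_abs_self _
          _ = |M| * |δ (S + n)| := abs_mul _ _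
          _ ≤ |M| * ε := mul_le_mul_of_nonneg_left hd.le (abs_nonneg _)
          _ ≤ K * ε := mul_le_mul_of_nonneg_right (by rw [hK]; linarith) hεpos.le
      have hsplit : a S (n + 1) - 1 = (a S (n + 1) - a S n) + (a S n - 1) := by ring
      calc |a S (n + 1) - 1| = |(a S (n + 1) - a S n) + (a S n - 1)| := by rw [hsplit]
        _ ≤ |a S (n + 1) - a S n| + |a S n - 1| := abs_add_le _ _
        _ ≤ K * ε + n * K * ε := add_le_add (h1.trans h2) ih'
        _ = ((n + 1 : ℕ) : ℝ) * K * ε := by push_cast; ring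
  have hfin := key n₀ le_rfl
  have hbound : (n₀ : ℝ) * K * ε ≤ 1 / 4 := by
    have h1 : (n₀ : ℝ) * K * ε = ((n₀ : ℝ) / (n₀ + 1)) / 4 := by
      rw [hε]; field_simp
    rw [h1]
    have h2 : (n₀ : ℝ) / (n₀ + 1) ≤ 1 := by
      rw [div_le_one (by positivity)]; linarith
    linarith
  have hdec : a S n₀ ≤ ρ n₀ := (le_abs_self _).trans (hdecay S n₀)
  have h34 : 1 - a S n₀ ≤ 1 / 4 := by
    have := (abs_sub_comm (a S n₀) 1) ▸ hfin
    linarith [le_abs_self (1 - a S n₀)]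
  linarith

/-! ## Card `escape-along-the-explosion` — abstract heart -/

section TopMode

variable {𝕜 E : Type*} [NontriviallyNormedField 𝕜] [NormedAddCommGroup E] [NormedSpace 𝕜 E]

/-- **TOP-MODE DOMINANCE (linear shadowing heart).** For a bounded operator `T` with a
`T`-invariant splitting given by an idempotent `P` commuting with `T`, contracting by `θ` on
`ker P` and expanding by `m > θ` on `range P` (dominated splitting: `P` = spectral projector of
the TOP growing mode plane, `θ` = growth of everything else), every datum with `P x ≠ 0` aligns
with `range P` under iteration: the off-plane part becomes negligible relative to the plane part.
Nonlinear version (strong-unstable shadowing near a bomb) is the line's stub; this is its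
first checkable statement. -/
theorem topModeDominance (T P : E →L[𝕜] E) (θ m : ℝ) (hPP : P.comp P = P)
    (hPT : P.comp T = T.comp P) (hθ : 0 ≤ θ) (hθm : θ < m)
    (hker : ∀ y, P y = 0 → ‖T y‖ ≤ θ * ‖y‖)
    (hran : ∀ y, m * ‖P y‖ ≤ ‖T (P y)‖)
    (x : E) (hx : P x ≠ 0) :
    Tendsto (fun n : ℕ ↦ ‖(T ^ n) x - P ((T ^ n) x)‖ / ‖P ((T ^ n) x)‖) atTop (𝓝 0) := by
  have hPT' : ∀ y, P (T y) = T (P y) := fun y ↦ by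
    simpa using congrArg (fun f : E →L[𝕜] E ↦ f y) hPT
  have hPP' : ∀ y, P (P y) = P y := fun y ↦ by
    simpa using congrArg (fun f : E →L[𝕜] E ↦ f y) hPP
  have hm : 0 < m := lt_of_le_of_lt hθ hθm
  -- `P` commutes with the powers
  have hcomm : ∀ n : ℕ, ∀ y, P ((T ^ n) y) = (T ^ n) (P y) := by
    intro n
    induction n with
    | zero => intro y; simp
    | succ n ih => intro y; rw [pow_succ, ContinuousLinearMap.mul_apply, ih, hPT',
        ContinuousLinearMap.mul_apply]
  -- contraction on `ker P`
  have hcontr : ∀ n : ℕ, ∀ z, P z = 0 → ‖(T ^ n) z‖ ≤ θ ^ n * ‖z‖ := by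
    intro n
    induction n with
    | zero => intro z _; simp
    | succ n ih =>
      intro z hz
      have hz' : P (T z) = 0 := by rw [hPT', hz, map_zero]
      rw [pow_succ, ContinuousLinearMap.mul_apply]
      calc ‖(T ^ n) (T z)‖ ≤ θ ^ n * ‖T z‖ := ih (T z) hz'
        _ ≤ θ ^ n * (θ * ‖z‖) := mul_le_mul_of_nonneg_left (hker z hz) (pow_nonneg hθ n)
        _ = θ ^ (n + 1) * ‖z‖ := by rw [pow_succ]; ring
  -- expansion on `range P`
  have hexp : ∀ n : ℕ, ∀ y, m ^ n * ‖P y‖ ≤ ‖(T ^ n) (P y)‖ := by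
    intro n
    induction n with
    | zero => intro y; simp
    | succ n ih =>
      intro y
      rw [show T ^ (n + 1) = T ^ n * T from pow_succ T n, ContinuousLinearMap.mul_apply, ← hPT']
      calc m ^ (n + 1) * ‖P y‖ = m ^ n * (m * ‖P y‖) := by rw [pow_succ]; ring
        _ ≤ m ^ n * ‖T (P y)‖ := mul_le_mul_of_nonneg_left (hran y) (pow_nonneg hm.le n)
        _ = m ^ n * ‖P (T y)‖ := by rw [hPT']
        _ ≤ ‖(T ^ n) (P (T y))‖ := ih (T y)
  have hPx : 0 < ‖P x‖ := norm_pos_iff.mpr hx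
  have hz0 : P (x - P x) = 0 := by rw [map_sub, hPP', sub_self]
  -- pointwise bounds on the ratio
  have hden : ∀ n : ℕ, 0 < ‖P ((T ^ n) x)‖ := fun n ↦
    lt_of_lt_of_le (mul_pos (pow_pos hm n) hPx) ((hexp n x).trans_eq (by rw [hcomm]))
  have hnum : ∀ n : ℕ, ‖(T ^ n) x - P ((T ^ n) x)‖ ≤ θ ^ n * ‖x - P x‖ := by
    intro n
    have h1 : (T ^ n) x - P ((T ^ n) x) = (T ^ n) (x - P x) := by rw [map_sub, hcomm]
    rw [h1]
    exact hcontr n _ hz0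
  have hratio : ∀ n : ℕ, ‖(T ^ n) x - P ((T ^ n) x)‖ / ‖P ((T ^ n) x)‖ ≤
      (θ / m) ^ n * (‖x - P x‖ / ‖P x‖) := by
    intro n
    rw [div_le_iff₀ (hden n)]
    have h2 : m ^ n * ‖P x‖ ≤ ‖P ((T ^ n) x)‖ := (hexp n x).trans_eq (by rw [hcomm])
    calc ‖(T ^ n) x - P ((T ^ n) x)‖ ≤ θ ^ n * ‖x - P x‖ := hnum n
      _ = (θ / m) ^ n * (‖x - P x‖ / ‖P x‖) * (m ^ n * ‖P x‖) := by
          rw [div_pow]; field_simp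
      _ ≤ (θ / m) ^ n * (‖x - P x‖ / ‖P x‖) * ‖P ((T ^ n) x)‖ :=
          mul_le_mul_of_nonneg_left h2 (by positivity)
  have hlim : Tendsto (fun n : ℕ ↦ (θ / m) ^ n * (‖x - P x‖ / ‖P x‖)) atTop (𝓝 0) := by
    have h1 : Tendsto (fun n : ℕ ↦ (θ / m) ^ n) atTop (𝓝 0) :=
      tendsto_pow_atTop_nhds_zero_of_lt_one (div_nonneg hθ hm.le) ((div_lt_one hm).mpr hθm)
    simpa using h1.mul_const (‖x - P x‖ / ‖P x‖)
  exact tendsto_of_tendsto_of_tendsto_of_le_of_le tendsto_const_nhds hlim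
    (fun n ↦ div_nonneg (norm_nonneg _) (norm_nonneg _)) hratio

end TopMode

/-! ## Typed interface of card `test-waves-certify-the-limit` with the route vocabulary -/

open Literature.Geometry.Lorentzian

/-- The TELESCOPE of `KerrOrBomb`: its five standing hypotheses on a stationary AF black hole
(vacuum, connected horizon, non-degenerate horizon, globally hyperbolic, `T ≠ 0` on the
d.o.c.), bundled. -/
def InTelescope (𝓑 : StationaryAFBlackHole.{0}) [𝓑.metric.HasLeviCivita] : Prop :=
  𝓑.metric.toPseudoRiemannianMetric.IsRicciFlat ∧ IsConnected 𝓑.horizon ∧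
    𝓑.toSpacetime.IsNonDegenerateHorizon 𝓑.Mext ∧
      𝓑.metric.IsGloballyHyperbolic 𝓑.timeOrientation ∧ ∀ p ∈ 𝓑.doc, 𝓑.killing p ≠ 0

/-- The fact-free Kerr-exterior conclusion of `KerrOrBomb` (verbatim). -/
def IsKerrExteriorFF (𝓑 : StationaryAFBlackHole.{0}) [Kerr.Facts] : Prop :=
  ∃ (M a : ℝ), Kerr.IsSubextremal M a ∧ ∃ Ψ : Kerr.exterior M a → 𝓑.carrier,
    Function.Injective Ψ ∧ Set.range Ψ = 𝓑.doc ∧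
      PseudoRiemannianMetric.IsIsometricImmersion
        (Kerr.smoothMetric M a (Kerr.rPlus M a)).toPseudoRiemannianMetric
        𝓑.metric.toPseudoRiemannianMetric Ψ

/-- `KerrOrBomb` reads: a telescope hole that is Killing-mode stable (SCALAR `□_g`, the tree's
`StationaryAFBlackHole.IsKillingModeStable`, `Iff.rfl` with the inlined clause) is a sub-extremal
Kerr exterior. This is the exact shape in which the reduction consumes the crux's hypothesis:
per limit hole, it must SUPPLY `InTelescope` and `IsKillingModeStable`. -/
theorem kerrOrBomb_iff_telescope :
    Theses.ZeroEnergyKerrOrBomb.KerrOrBomb ↔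
      ∀ (𝓑 : StationaryAFBlackHole.{0}) [𝓑.metric.HasLeviCivita] [Kerr.Facts],
        InTelescope 𝓑 → 𝓑.IsKillingModeStable → IsKerrExteriorFF 𝓑 := by
  constructor
  · intro h 𝓑 _ _ hT hms
    obtain ⟨h1, h2, h3, h4, h5⟩ := hT
    exact h 𝓑 h1 h2 h3 h4 h5 hms
  · intro h 𝓑 _ _ h1 h2 h3 h4 h5 hms
    exact h 𝓑 ⟨h1, h2, h3, h4, h5⟩ hms

section Interface

variable {𝓢 : Spacetime.{0} 4} {𝒪 : Set 𝓢.carrier} {k : ℕ}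

/-- The unit forcing box of hole `i` at chart time `s` and radius `R`: the chart image of
`{x ∈ Uᵢ | s ≤ tᵢ(x) ≤ s + 1, rᵢ(x) ≤ R}`. -/
def forcingBox (d : StationaryFinalStateDecomposition 𝓢 𝒪 k) (i : Fin d.N) (s R : ℝ) :
    Set 𝓢.carrier :=
  d.toOver.chart i '' {x | s ≤ (d.background i).time x.1 ∧ (d.background i).time x.1 ≤ s + 1 ∧
    (d.background i).radius x.1 ≤ R}

/-- **FORWARD TEST-BOUNDEDNESS near hole `i`** (the test-wave clause the card asks the dynamics
stub to deliver for Christodoulou-generic data; start-time uniform, gauge-free, scalar):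
from some chart time `τ₁` on, for every near-zone radius `R` there is ONE constant `C` such that
for every start time `s ≥ τ₁`, every smooth `u` on the development whose wave-forcing `□_g u`
is supported in the unit box at time `s` and which is RETARDED (`u = 0` off `J⁺(box)`) obeys
`|u| ≤ C · sup |□_g u|` on the near zone `{tᵢ ≥ s + 1, rᵢ ≤ R}`. By linearity and superposition
over start times this is exactly the uniform propagator bound `M` of `modeRoughness` in Duhamel
form. True on developments settling to sub-extremal Kerr (pointwise boundedness of forced waves,
Dafermos–Rodnianski–Shlapentokh-Rothman + Ma–Szeftel robustness); false near a bomb. -/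
def ForwardTestBounded [𝓢.metric.HasLeviCivita] (d : StationaryFinalStateDecomposition 𝓢 𝒪 k)
    (i : Fin d.N) : Prop :=
  ∃ τ₁ : ℝ, ∀ R : ℝ, ∃ C : ℝ, ∀ s : ℝ, τ₁ ≤ s →
    ∀ u : 𝓢.carrier → ℝ, ContMDiff (𝓡 4) 𝓘(ℝ, ℝ) ((⊤ : ℕ∞) : WithTop ℕ∞) u →
      (∀ x, 𝓢.metric.dalembertian u x ≠ 0 → x ∈ forcingBox d i s R) →
      (∀ x, x ∉ 𝓢.metric.causalFuture 𝓢.timeOrientation (forcingBox d i s R) → u x = 0) →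
      ∀ A : ℝ, (∀ x, |𝓢.metric.dalembertian u x| ≤ A) →
        ∀ x : (d.background i).domain, s + 1 ≤ (d.background i).time x.1 →
          (d.background i).radius x.1 ≤ R → |u (d.toOver.chart i x)| ≤ C * A

end Interface

/-- **INTERFACE TARGET of the card** (the provable stub that discharges the crux's peculiar
hypothesis on a limit object): for every `C²` stationary final-state decomposition of a vacuum
spacetime, forward test-boundedness near hole `i` forces the model hole `𝓑ᵢ` to be Killing-mode
stable — contrapositive of `modeRoughness` with `v` = the transplanted (truncated) growing mode,
`δ` = slab deviation, `M` = `C`. No rate, no rigidity, no gravitational mode theory. -/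
def LimitHolesAreModeStable : Prop :=
  ∀ (𝓢 : Spacetime.{0} 4) [𝓢.metric.HasLeviCivita] (𝒪 : Set 𝓢.carrier)
    (d : StationaryFinalStateDecomposition 𝓢 𝒪 2) (i : Fin d.N),
    ∀ [(d.hole i).metric.HasLeviCivita],
      ForwardTestBounded d i → (d.hole i).IsKillingModeStable

/-- What the reduction then gets from the crux's hypothesis, per hole (pure composition of
`kerrOrBomb_iff_telescope` and `LimitHolesAreModeStable`; the remaining debts of the line —
`InTelescope` of the limit holes, `ForwardTestBounded` for generic data, chart re-adaptation —
are the other stubs). -/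
def LimitHolesAreKerr : Prop :=
  Theses.ZeroEnergyKerrOrBomb.KerrOrBomb → LimitHolesAreModeStable →
    ∀ (𝓢 : Spacetime.{0} 4) [𝓢.metric.HasLeviCivita] (𝒪 : Set 𝓢.carrier)
      (d : StationaryFinalStateDecomposition 𝓢 𝒪 2) (i : Fin d.N),
      ∀ [(d.hole i).metric.HasLeviCivita] [Kerr.Facts],
        InTelescope (d.hole i) → ForwardTestBounded d i → IsKerrExteriorFF (d.hole i)

theorem limitHolesAreKerr : LimitHolesAreKerr := by
  intro hKOB hLMS 𝓢 _ 𝒪 d i _ _ hT hFB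
  exact (kerrOrBomb_iff_telescope.mp hKOB) (d.hole i) hT (hLMS 𝓢 𝒪 d i hFB)

end Summit.FinalStateConjecture.FinalStateConjecture.Cruxes.StationaryLimitReduction.Ideator3

end
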